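import Literature.AlgebraicGeometry.Morphisms.CechH1Refinement
import HarnessLib

/-!
# Čech `Ȟ¹(𝒰, 𝒪)`: pullback along composites and identities; independence of the refinement map

Complements to `Morphisms/CechH1Pullback` and `Morphisms/CechH1Refinement` (Görtz–Wedhorn II,
(21.16); The Stacks Project, Tag 01ED, Tag 09UY):

* `cechComapC1_comp`, `cechComapH1_comp` — `(h ≫ g)^* = h^* ∘ g^*` on Čech cochains and on
  `Ȟ¹` (the preimage families agree definitionally, `Scheme.Hom.comp_preimage`);
* `cechComapC1_id`, `cechComapH1_id` — `(𝟙_X)^* = id`;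
* `cechComapH1_congr` — dependence on the morphism only through its value (transport along
  `g = g'`);
* `cechRefineC1_sub_mem_cechB1`, `cechRefineH1_eq_cechRefineH1` — **Görtz–Wedhorn II,
  Lemma 21.72 in degree one**: two maps of coverings `τ, τ' : 𝒱 → 𝒰` induce the same map
  `Ȟ¹(𝒰, 𝒪_X) → Ȟ¹(𝒱, 𝒪_X)` (the cochain homotopy `h_j = c_{τ j, τ' j} |_{V_j}`).

These are bookkeeping tools for the Künneth computation of `Ȟ¹` on product coverings
(`Motives/KunnethH1ProductCover`). Mathlib searched (pin): `Scheme.Hom.appLE_comp_appLE`,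
`Scheme.Hom.comp_preimage`, `Scheme.Hom.appLE_id`? (identity handled via `Scheme.Hom.app_eq_appLE`);
Mathlib has no Čech cohomology of schemes.

## References

* U. Görtz, T. Wedhorn, *Algebraic Geometry II: Cohomology of Schemes*, Springer Spektrum (2023),
  doi:10.1007/978-3-658-43031-3: (21.16) and Lemma 21.72, p. 262 (read via the held copy).
  [GortzWedhorn2023]
* The Stacks Project, Tag 01ED, Tag 09UY. [StacksProject]
-/

noncomputable section

open CategoryTheory AlgebraicGeometry Limits TopologicalSpace Opposite

universe u v w

namespace Literature.AlgebraicGeometry.Morphisms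

variable {A : Type u} [CommRing A] {X Y Z : Scheme.{u}} (fX : X ⟶ Spec (.of A))
  (fY : Y ⟶ Spec (.of A)) (fZ : Z ⟶ Spec (.of A))

/-! ## Pullback along composites -/

section Comp

variable (g : Y ⟶ X) (h : Z ⟶ Y)
variable {ι : Type v} (U : ι → X.Opens)

/-- `(h ≫ g) ≫ f_X = f_Z`. [folklore] -/
theorem comp_comp_eq (hg : g ≫ fX = fY) (hh : h ≫ fY = fZ) : (h ≫ g) ≫ fX = fZ := by
  rw [Category.assoc, hg, hh]

/-- **`(h ≫ g)^* = h^* ∘ g^*` on sections** (Mathlib `Scheme.Hom.appLE_comp_appLE`). [folklore] -/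
theorem Sections.comap_comp (hg : g ≫ fX = fY) (hh : h ≫ fY = fZ) {V : X.Opens} {W : Y.Opens}
    {T : Z.Opens} (e : W ≤ g ⁻¹ᵁ V) (e' : T ≤ h ⁻¹ᵁ W) (s : Sections fX V) :
    Sections.comap fY fZ h hh e' (Sections.comap fX fY g hg e s) =
      Sections.comap fX fZ (h ≫ g) (comp_comp_eq fX fY fZ g h hg hh)
        (e'.trans fun _ hx => e hx) s := by
  rw [Sections.comap_apply, Sections.comap_apply, Sections.comap_apply, ← CommRingCat.comp_apply,
    Scheme.Hom.appLE_comp_appLE]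

/-- **`(h ≫ g)^* = h^* ∘ g^*` on Čech `1`-cochains** (the preimage family of `𝒰` under `h ≫ g`
is the preimage under `h` of the preimage under `g`, definitionally). [folklore] -/
theorem cechComapC1_comp (hg : g ≫ fX = fY) (hh : h ≫ fY = fZ) (c : CechC1 fX U) :
    cechComapC1 fY fZ h hh (preimageFamily g U) (cechComapC1 fX fY g hg U c) =
      cechComapC1 fX fZ (h ≫ g) (comp_comp_eq fX fY fZ g h hg hh) U c := by
  funext i j
  rw [cechComapC1_apply, cechComapC1_apply, cechComapC1_apply]
  exact Sections.comap_comp fX fY fZ g h hg hh _ _ (c i j)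

/-- **`(h ≫ g)^* = h^* ∘ g^*` on `Ȟ¹`.** [folklore] -/
theorem cechComapH1_comp (hg : g ≫ fX = fY) (hh : h ≫ fY = fZ) (x : CechH1 fX U) :
    cechComapH1 fY fZ h hh (preimageFamily g U) (cechComapH1 fX fY g hg U x) =
      cechComapH1 fX fZ (h ≫ g) (comp_comp_eq fX fY fZ g h hg hh) U x := by
  obtain ⟨z, rfl⟩ := CechH1.mk_surjective fX U x
  rw [cechComapH1_mk, cechComapH1_mk, cechComapH1_mk]
  congr 1
  ext : 1
  simp only [cechComapZ1_coe]
  exact cechComapC1_comp fX fY fZ g h U hg hh z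

end Comp

/-! ## Pullback along the identity and along equal morphisms -/

section Id

variable {ι : Type v} (U : ι → X.Opens)

/-- `(𝟙_X)^*` is the identity on sections. [folklore] -/
theorem Sections.comap_id {V : X.Opens} (s : Sections fX V) :
    Sections.comap fX fX (𝟙 X) (Category.id_comp fX) (le_refl V : V ≤ (𝟙 X) ⁻¹ᵁ V) s = s := by
  rw [Sections.comap_apply, Scheme.Hom.appLE, Scheme.Hom.id_app]
  erw [Category.id_comp]
  exact Sections.res_self fX s

/-- `(𝟙_X)^*` is the identity on Čech `1`-cochains. [folklore] -/
theorem cechComapC1_id (c : CechC1 fX U) :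
    cechComapC1 fX fX (𝟙 X) (Category.id_comp fX) U c = c := by
  funext i j
  rw [cechComapC1_apply]
  exact Sections.comap_id fX (c i j)

/-- `(𝟙_X)^*` is the identity on `Ȟ¹`. [folklore] -/
theorem cechComapH1_id (x : CechH1 fX U) :
    cechComapH1 fX fX (𝟙 X) (Category.id_comp fX) U x = x := by
  obtain ⟨z, rfl⟩ := CechH1.mk_surjective fX U x
  rw [cechComapH1_mk]
  congr 1
  ext : 1
  simp only [cechComapZ1_coe]
  exact cechComapC1_id fX U z

variable {fX}

/-- Transport of `g^* x = 0` along an equality of morphisms `g = g'`. [folklore] -/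
theorem cechComapH1_congr_eq_zero_iff {g g' : Y ⟶ X} (e : g = g') (hg : g ≫ fX = fY)
    (hg' : g' ≫ fX = fY) (x : CechH1 fX U) :
    cechComapH1 fX fY g hg U x = 0 ↔ cechComapH1 fX fY g' hg' U x = 0 := by
  subst e
  rfl

end Id

/-! ## Two maps of coverings induce the same map on `Ȟ¹` -/

section Homotopy

variable {ι : Type v} {ι' : Type w} (U : ι → X.Opens) (V : ι' → X.Opens) (τ τ' : ι' → ι)
  (hτ : ∀ j, V j ≤ U (τ j)) (hτ' : ∀ j, V j ≤ U (τ' j))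

/-- **Görtz–Wedhorn II, Lemma 21.72 in degree one, cochain form**: for two maps of coverings
`τ, τ' : 𝒱 → 𝒰` and a cocycle `c` on `𝒰`, `ρ_τ c - ρ_{τ'} c = d⁰(-h)` with
`h_j = c_{τ j, τ' j} |_{V_j}`. [cite: GortzWedhorn2023, Lemma 21.72 (p. 262)] -/
theorem cechRefineC1_sub_mem_cechB1 {c : CechC1 fX U} (hc : c ∈ cechZ1 fX U) :
    cechRefineC1 fX U V τ hτ c - cechRefineC1 fX U V τ' hτ' c ∈ cechB1 fX V := by
  refine (mem_cechB1_iff fX V _).mpr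
    ⟨fun j => -Sections.res fX (le_inf (hτ j) (hτ' j)) (c (τ j) (τ' j)), ?_⟩
  funext j j'
  simp only [cechD0_apply, Pi.sub_apply, cechRefineC1_apply, map_neg, Sections.res_res]
  have hj : V j ⊓ V j' ≤ U (τ j) := inf_le_left.trans (hτ j)
  have hj₂ : V j ⊓ V j' ≤ U (τ' j) := inf_le_left.trans (hτ' j)
  have hj' : V j ⊓ V j' ≤ U (τ j') := inf_le_right.trans (hτ j')
  have hj'₂ : V j ⊓ V j' ≤ U (τ' j') := inf_le_right.trans (hτ' j')
  -- `c_{τj,τj'} + c_{τj',τ'j'} = c_{τj,τ'j'} = c_{τj,τ'j} + c_{τ'j,τ'j'}`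
  have h1 := cechZ1.cocycle_res fX U hc (τ j) (τ j') (τ' j') hj hj' hj'₂
  have h2 := cechZ1.cocycle_res fX U hc (τ j) (τ' j) (τ' j') hj hj₂ hj'₂
  linear_combination h2 - h1

/-- **Görtz–Wedhorn II, Lemma 21.72 in degree one**: two maps of coverings `τ, τ' : 𝒱 → 𝒰`
induce the same map `Ȟ¹(𝒰, 𝒪_X) → Ȟ¹(𝒱, 𝒪_X)`. [cite: GortzWedhorn2023, Lemma 21.72 (p. 262)] -/
theorem cechRefineH1_eq_cechRefineH1 (x : CechH1 fX U) :
    cechRefineH1 fX U V τ hτ x = cechRefineH1 fX U V τ' hτ' x := by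
  obtain ⟨z, rfl⟩ := CechH1.mk_surjective fX U x
  rw [cechRefineH1_mk, cechRefineH1_mk, CechH1.mk_eq_mk_iff, cechRefineZ1_coe, cechRefineZ1_coe]
  exact cechRefineC1_sub_mem_cechB1 fX U V τ τ' hτ hτ' z.2

/-- Refinement of a family to itself (along any map of coverings) is the identity on `Ȟ¹`.
[folklore] -/
theorem cechRefineH1_self (σ : ι → ι) (hσ : ∀ i, U i ≤ U (σ i)) (x : CechH1 fX U) :
    cechRefineH1 fX U U σ hσ x = x := by
  rw [cechRefineH1_eq_cechRefineH1 fX U U σ id hσ (fun _ => le_rfl)]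
  obtain ⟨z, rfl⟩ := CechH1.mk_surjective fX U x
  rw [cechRefineH1_mk]
  congr 1
  ext i j : 3
  rw [cechRefineZ1_coe, cechRefineC1_apply]
  exact Sections.res_self fX _

/-- Refinements compose: `ρ_σ (ρ_τ x) = ρ_{τ ∘ σ} x` on `Ȟ¹` (indeed on cochains). [folklore] -/
theorem cechRefineH1_refineH1 {ι'' : Type*} (W : ι'' → X.Opens) (σ : ι'' → ι')
    (hσ : ∀ l, W l ≤ V (σ l)) (x : CechH1 fX U) :
    cechRefineH1 fX V W σ hσ (cechRefineH1 fX U V τ hτ x) =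
      cechRefineH1 fX U W (τ ∘ σ) (fun l => (hσ l).trans (hτ (σ l))) x := by
  obtain ⟨z, rfl⟩ := CechH1.mk_surjective fX U x
  rw [cechRefineH1_mk, cechRefineH1_mk, cechRefineH1_mk]
  congr 1
  ext l l' : 3
  simp only [cechRefineZ1_coe, cechRefineC1_apply, Sections.res_res]
  rfl

end Homotopy

end Literature.AlgebraicGeometry.Morphisms

end
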